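import Mathlib.Data.Int.ModEq
import Mathlib.Data.Int.GCD
import Mathlib.Data.Nat.Size
import Mathlib.Algebra.BigOperators.Fin
import Mathlib.Algebra.BigOperators.ModEq
import Mathlib.Logic.Equiv.Basic
import Mathlib.Logic.Function.Basic
import Mathlib.Tactic.Ring
import HarnessLib

/-!
# Euclid's algorithm on pairs of rows and pairs of columns of a linear system modulo `N + 1`

Topic `Literature/LinearAlgebra/Matrix`.  Support file (linear algebra as a FUNCTIONAL PROGRAM on
lists of natural numbers, every stored number a residue `≤ N`) for the polynomial-time decision of
solvability of systems of linear DIOPHANTINE equations (`IntegerLinearSolvability.lean`, whose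
machine realisation is `Literature/Computability/Complexity/IntegerLinearSolvabilityFP.lean`): the
modular stage decides `∃ x ∈ ℤᶜ, A x ≡ b (mod N + 1)` by bringing the augmented matrix to diagonal
shape with unimodular row operations on the augmented rows and unimodular column operations on the
coefficient columns, all entries reduced modulo `N + 1` after every operation (so that numbers never
grow — the point of the modular technique for Hermite/Smith normal forms, Domich–Kannan–Trotter 1987;
here only the diagonal SHAPE is produced, which suffices to decide solvability).  This file has the
two-line engines and their invariants:

* `Sat N c x r`: the augmented row `r = [a₀, …, a_{c-1}, b]` (a list of naturals, `r[c]` the right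
  hand side) holds at `x : ℕ → ℤ` modulo `N + 1`, i.e. `∑_{i<c} aᵢ xᵢ ≡ b`;
* `msub`, `axpy` (`v - q • u` reduced), `estep`/`euclid` — Euclid's algorithm on a pair of rows keyed
  by their first entries (a transvection, then a swap unless the key became `0`): it preserves the
  solution set (`sat_euclid_iff`), its keys follow `kstep` (`keys_euclid`), and it leaves the first
  row untouched when its key divides the other key (`euclid_fst_eq_of_dvd`);
* `colOp`, `swapCols`, `cstep`/`ceuclid` — the same algorithm on columns `0` and `j` of a row list,
  keyed by the top row, as maps over the rows; it preserves SOLVABILITY (`ceuclid_invariants`, by an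
  explicit change of unknowns) and has the same key dynamics (`ckeys_ceuclid`);
* `kstep`/`kiter` — the common dynamics of the pair of keys, with the halving argument
  (`kiter_spec`: from `(p, a)` with `0 < p ≤ N`, after `F ≥ 2 · size N + 1` steps the pair is
  `(gcd p a, 0)`).

Everything is proved; Mathlib only.

## References

* P. D. Domich, R. Kannan, L. E. Trotter, *Hermite normal form computation using modulo determinant
  arithmetic*, Math. Oper. Res. 12 (1987) 50–59 — the modular technique; cited for the method only.
* A. Schrijver, *Theory of Linear and Integer Programming*, Wiley 1986, §4.1–§5.3 (unimodular
  row/column operations preserve integer solvability; polynomiality via reduction modulo a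
  sub-determinant) — cited for the method only; everything here is proved.
-/

namespace Literature.LinearAlgebra.Matrix

namespace ModDiag

open Finset

variable (N : ℕ)

/-! ### Modular arithmetic on residues -/

/-- `msub N a t`: the residue in `[0, N]` of `a - t` modulo `N + 1`. [folklore] -/
def msub (a t : ℕ) : ℕ := (a % (N + 1) + (N + 1 - t % (N + 1))) % (N + 1)

/-- `msub` is a residue. [folklore] -/
theorem msub_lt (a t : ℕ) : msub N a t < N + 1 := Nat.mod_lt _ N.succ_pos

/-- `msub N a t ≡ a - t (mod N + 1)`. [folklore] -/
theorem msub_modEq (a t : ℕ) : ((msub N a t : ℕ) : ℤ) ≡ (a : ℤ) - t [ZMOD ((N : ℤ) + 1)] := by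
  have hm : ((N + 1 : ℕ) : ℤ) = (N : ℤ) + 1 := by push_cast; ring
  have ht : t % (N + 1) ≤ N + 1 := (Nat.mod_lt _ N.succ_pos).le
  unfold msub
  rw [Int.natCast_emod, Nat.cast_add, Nat.cast_sub ht, Int.natCast_emod, Int.natCast_emod, hm]
  refine (Int.mod_modEq _ _).trans ?_
  have h1 : (a : ℤ) % ((N : ℤ) + 1) ≡ a [ZMOD ((N : ℤ) + 1)] := Int.mod_modEq _ _
  have h2 : ((N : ℤ) + 1) - (t : ℤ) % ((N : ℤ) + 1) ≡ 0 - t [ZMOD ((N : ℤ) + 1)] :=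
    Int.ModEq.sub Int.modulus_modEq_zero (Int.mod_modEq _ _)
  have h3 := h1.add h2
  rw [zero_sub, ← sub_eq_add_neg] at h3
  exact h3

/-- On residues `t ≤ a ≤ N` the modular difference is the difference. [folklore] -/
theorem msub_eq_sub {a t : ℕ} (hta : t ≤ a) (ha : a < N + 1) : msub N a t = a - t := by
  unfold msub
  rw [Nat.mod_eq_of_lt ha, Nat.mod_eq_of_lt (lt_of_le_of_lt hta ha)]
  have : a + (N + 1 - t) = (N + 1) + (a - t) := by omega
  rw [this, Nat.add_mod_left, Nat.mod_eq_of_lt (by omega)]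

/-! ### Augmented rows and their satisfaction modulo `N + 1` -/

/-- The `i`-th entry of a row, as an integer (`0` beyond the end). [folklore] -/
def ent (r : List ℕ) (i : ℕ) : ℤ := (r.getD i 0 : ℕ)

/-- `Sat N c x r`: the augmented row `r` (coefficients `r[0..c-1]`, right hand side `r[c]`) holds
at `x` modulo `N + 1`: `∑_{i<c} r[i] · x i ≡ r[c]`. [folklore] -/
def Sat (c : ℕ) (x : ℕ → ℤ) (r : List ℕ) : Prop :=
  (∑ i : Fin c, ent r i * x i) ≡ ent r c [ZMOD ((N : ℤ) + 1)]

/-- `Solvable N c M`: the system of augmented rows `M` in `c` unknowns has a solution modulo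
`N + 1`. [folklore] -/
def Solvable (c : ℕ) (M : List (List ℕ)) : Prop := ∃ x : ℕ → ℤ, ∀ r ∈ M, Sat N c x r

/-- A row list is WELL-FORMED for `c` unknowns: every row has length `c + 1`. [folklore] -/
def WF (c : ℕ) (M : List (List ℕ)) : Prop := ∀ r ∈ M, r.length = c + 1

/-- A row list is REDUCED: every entry is a residue `≤ N`. [folklore] -/
def Reduced (M : List (List ℕ)) : Prop := ∀ r ∈ M, ∀ a ∈ r, a < N + 1

variable {N}

/-- `getD` beyond the end is the default. [folklore] -/
theorem getD_of_le {r : List ℕ} {i : ℕ} (h : r.length ≤ i) : r.getD i 0 = 0 := by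
  rw [List.getD_eq_getElem?_getD, List.getElem?_eq_none h]; rfl

/-- Entries of a reduced row are residues. [folklore] -/
theorem getD_lt_of_reduced {r : List ℕ} (h : ∀ a ∈ r, a < N + 1) (i : ℕ) : r.getD i 0 < N + 1 := by
  rw [List.getD_eq_getElem?_getD]
  cases hri : r[i]? with
  | none => exact N.succ_pos
  | some a => exact h a (List.mem_of_getElem? hri)

/-! ### `v - q • u`, reduced -/

variable (N)

/-- `axpy N q u v = v - q • u` entrywise, reduced modulo `N + 1` (truncating to the shorter
length). [folklore] -/
def axpy (q : ℕ) (u v : List ℕ) : List ℕ := List.zipWith (fun a b => msub N a (q * b)) v u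

variable {N}

/-- Length of `axpy` for rows of equal length. [folklore] -/
theorem length_axpy {q : ℕ} {u v : List ℕ} (h : u.length = v.length) : (axpy N q u v).length = v.length := by
  simp [axpy, h]

/-- Entries of `axpy`. [folklore] -/
theorem getD_axpy {q : ℕ} {u v : List ℕ} (h : u.length = v.length) (i : ℕ) :
    (axpy N q u v).getD i 0 = if i < v.length then msub N (v.getD i 0) (q * u.getD i 0) else 0 := by
  simp only [axpy, List.getD_eq_getElem?_getD, List.getElem?_zipWith]
  split_ifs with hi
  · rw [List.getElem?_eq_getElem hi, List.getElem?_eq_getElem (h ▸ hi)]; rfl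
  · rw [List.getElem?_eq_none (not_lt.1 hi)]; rfl

/-- `axpy` is reduced (for rows of equal length). [folklore] -/
theorem axpy_lt {q : ℕ} {u v : List ℕ} (h : u.length = v.length) : ∀ a ∈ axpy N q u v, a < N + 1 := by
  intro a ha
  obtain ⟨i, hi, rfl⟩ := List.getElem_of_mem ha
  have e : (axpy N q u v)[i] = (axpy N q u v).getD i 0 := by
    rw [List.getD_eq_getElem?_getD, List.getElem?_eq_getElem hi]; rfl
  rw [e, getD_axpy h]
  split_ifs
  · exact msub_lt N _ _
  · exact N.succ_pos

/-- Entries of `axpy` are congruent to `v[i] - q u[i]`. [folklore] -/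
theorem ent_axpy_modEq {q : ℕ} {u v : List ℕ} (h : u.length = v.length) (i : ℕ) :
    ent (axpy N q u v) i ≡ ent v i - q * ent u i [ZMOD ((N : ℤ) + 1)] := by
  unfold ent
  rw [getD_axpy h]
  split_ifs with hi
  · simpa using msub_modEq N (v.getD i 0) (q * u.getD i 0)
  · rw [getD_of_le (not_lt.1 hi), getD_of_le (not_lt.1 (h ▸ hi))]
    simp

/-- **A transvection preserves satisfaction**: if `u` holds at `x` then `v - q • u` holds at `x`
iff `v` does. [cite: Schrijver1986, §4.1 (unimodular operations)] -/
theorem sat_axpy_iff {c q : ℕ} {x : ℕ → ℤ} {u v : List ℕ} (h : u.length = v.length)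
    (hu : Sat N c x u) : Sat N c x (axpy N q u v) ↔ Sat N c x v := by
  unfold Sat at *
  have hl : (∑ i : Fin c, ent (axpy N q u v) i * x i) ≡
      (∑ i : Fin c, ent v i * x i) - q * ∑ i : Fin c, ent u i * x i [ZMOD ((N : ℤ) + 1)] := by
    rw [Finset.mul_sum, ← Finset.sum_sub_distrib]
    refine Int.ModEq.sum fun i _ => ?_
    have := (ent_axpy_modEq (N := N) (q := q) h i).mul_right (x i)
    simpa [sub_mul, mul_assoc] using this
  have hr : ent (axpy N q u v) c ≡ ent v c - q * ent u c [ZMOD ((N : ℤ) + 1)] := ent_axpy_modEq h c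
  constructor
  · intro hs
    have h1 := (hl.symm.trans hs).trans hr
    have h2 := h1.add (hu.mul_left (q : ℤ))
    simpa using h2
  · intro hs
    refine hl.trans (Int.ModEq.trans ?_ hr.symm)
    exact hs.sub (hu.mul_left (q : ℤ))

/-! ### The dynamics of a pair of keys -/

/-- One Euclid step on a pair of keys `(p, a)`: nothing if `a = 0`; `(p, 0)` if `p ∣ a`; else
`(a mod p, p)`. [folklore] -/
def kstep (k : ℕ × ℕ) : ℕ × ℕ :=
  if k.2 = 0 then k else if k.2 % k.1 = 0 then (k.1, 0) else (k.2 % k.1, k.1)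

/-- Iterated key steps. [folklore] -/
def kiter : ℕ → ℕ × ℕ → ℕ × ℕ
  | 0, k => k
  | F + 1, k => kiter F (kstep k)

/-- A finished pair is fixed. [folklore] -/
theorem kstep_of_snd_eq_zero {k : ℕ × ℕ} (h : k.2 = 0) : kstep k = k := by simp [kstep, h]

/-- A finished pair stays. [folklore] -/
theorem kiter_of_snd_eq_zero {k : ℕ × ℕ} (h : k.2 = 0) (F : ℕ) : kiter F k = k := by
  induction F with
  | zero => rfl
  | succ F ih => rw [kiter, kstep_of_snd_eq_zero h, ih]

/-- `kiter` composes. [folklore] -/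
theorem kiter_add (F G : ℕ) (k : ℕ × ℕ) : kiter (F + G) k = kiter G (kiter F k) := by
  induction F generalizing k with
  | zero => simp [kiter]
  | succ F ih => rw [Nat.succ_add]; exact ih (kstep k)

/-- The gcd of the pair is invariant. [folklore] -/
theorem gcd_kstep (k : ℕ × ℕ) : Nat.gcd (kstep k).1 (kstep k).2 = Nat.gcd k.1 k.2 := by
  obtain ⟨p, a⟩ := k
  unfold kstep
  dsimp only
  split_ifs with h0 h1
  · rfl
  · have hdvd : p ∣ a := Nat.dvd_of_mod_eq_zero h1
    rw [Nat.gcd_zero_right, Nat.gcd_eq_left hdvd]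
  · exact (Nat.gcd_rec p a).symm

/-- The gcd of the pair is invariant along the iteration. [folklore] -/
theorem gcd_kiter (F : ℕ) (k : ℕ × ℕ) : Nat.gcd (kiter F k).1 (kiter F k).2 = Nat.gcd k.1 k.2 := by
  induction F generalizing k with
  | zero => rfl
  | succ F ih => rw [kiter, ih, gcd_kstep]

/-- A positive first key stays positive. [folklore] -/
theorem kstep_fst_pos {k : ℕ × ℕ} (h : 0 < k.1) : 0 < (kstep k).1 := by
  unfold kstep
  split_ifs with h0 h1
  · exact h
  · exact h
  · exact Nat.pos_of_ne_zero h1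

/-- A positive first key stays positive along the iteration. [folklore] -/
theorem kiter_fst_pos {k : ℕ × ℕ} (h : 0 < k.1) (F : ℕ) : 0 < (kiter F k).1 := by
  induction F generalizing k with
  | zero => exact h
  | succ F ih => exact ih (kstep_fst_pos h)

/-- If the first key divides the second, one step finishes without touching the first key.
[folklore] -/
theorem kstep_of_dvd {p a : ℕ} (h : p ∣ a) : kstep (p, a) = (p, 0) := by
  unfold kstep
  dsimp only
  split_ifs with h0 h1
  · rw [h0]
  · rfl
  · exact absurd (Nat.mod_eq_zero_of_dvd h) h1

/-- If the first key divides the second, the iteration is `(p, 0)` from the first step on.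
[folklore] -/
theorem kiter_of_dvd {p a : ℕ} (h : p ∣ a) {F : ℕ} (hF : 1 ≤ F) : kiter F (p, a) = (p, 0) := by
  obtain ⟨F, rfl⟩ := Nat.exists_eq_add_of_le' hF
  rw [kiter, kstep_of_dvd h, kiter_of_snd_eq_zero rfl]

/-- **Two steps halve the first key** (unless they finish): from `(p, a)` with `a ≠ 0`, `p ∤ a`,
two steps give either a finished pair or a pair with first key `p'`, `2 p' < p`. [folklore] -/
theorem kstep_kstep {p a : ℕ} (ha : a ≠ 0) (hpa : a % p ≠ 0) :
    (kstep (kstep (p, a))).2 = 0 ∨ 2 * (kstep (kstep (p, a))).1 < p := by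
  have e1 : kstep (p, a) = (a % p, p) := by simp [kstep, ha, hpa]
  rw [e1]
  rcases Nat.eq_zero_or_pos p with rfl | hp
  · left; simp [kstep]
  set p₁ := a % p with hp₁
  have hp₁p : p₁ < p := Nat.mod_lt _ hp
  have hp₁0 : 0 < p₁ := Nat.pos_of_ne_zero hpa
  unfold kstep
  dsimp only
  split_ifs with h0 h1
  · omega
  · left; rfl
  · right
    show 2 * (p % p₁) < p
    by_cases hle : 2 * p₁ ≤ p
    · have := Nat.mod_lt p hp₁0; omega
    · have hdiv : p / p₁ = 1 := Nat.div_eq_of_lt_le (by omega) (by omega)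
      have := Nat.mod_add_div p p₁
      rw [hdiv] at this
      omega

/-- **Termination of the key dynamics**: from `(p, a)` with `0 < p`, `size p ≤ n`, after
`F ≥ 2 n + 1` steps the pair is finished. [folklore] -/
theorem kiter_snd_eq_zero : ∀ (n p a F : ℕ), 0 < p → Nat.size p ≤ n → 2 * n + 1 ≤ F →
    (kiter F (p, a)).2 = 0 := by
  intro n
  induction n with
  | zero =>
    intro p a F hp hs
    have := Nat.size_eq_zero.1 (Nat.le_zero.1 hs); omega
  | succ n ih =>
    intro p a F hp hs hF
    by_cases ha : a = 0
    · subst ha; rw [kiter_of_snd_eq_zero rfl]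
    by_cases hpa : a % p = 0
    · rw [kiter_of_dvd (Nat.dvd_of_mod_eq_zero hpa) (by omega)]
    obtain ⟨F', rfl⟩ : ∃ F', F = F' + 2 := ⟨F - 2, by omega⟩
    rw [show F' + 2 = 2 + F' from Nat.add_comm _ _, kiter_add]
    change (kiter F' (kstep (kstep (p, a)))).2 = 0
    rcases kstep_kstep ha hpa with hfin | hlt
    · rw [kiter_of_snd_eq_zero hfin]; exact hfin
    · have hkpos : 0 < (kstep (kstep (p, a))).1 := kstep_fst_pos (kstep_fst_pos hp)
      have hsize : Nat.size (kstep (kstep (p, a))).1 ≤ n := by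
        have h1 : p < 2 ^ (n + 1) := Nat.size_le.1 hs
        apply Nat.size_le.2
        have h2 : 2 * (kstep (kstep (p, a))).1 < 2 ^ (n + 1) := lt_trans hlt h1
        rw [pow_succ] at h2
        omega
      exact ih _ (kstep (kstep (p, a))).2 F' hkpos hsize (by omega)

/-- **The key dynamics computes the gcd**: from `(p, a)` with `0 < p ≤ N`, after
`F ≥ 2 · size N + 1` steps the pair is `(gcd p a, 0)`. [folklore] -/
theorem kiter_spec {p a F : ℕ} (hp : 0 < p) (hpN : p ≤ N) (hF : 2 * Nat.size N + 1 ≤ F) :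
    kiter F (p, a) = (Nat.gcd p a, 0) := by
  have h2 : (kiter F (p, a)).2 = 0 :=
    kiter_snd_eq_zero (Nat.size N) p a F hp (Nat.size_le_size hpN) hF
  have h1 := gcd_kiter F (p, a)
  rw [h2, Nat.gcd_zero_right] at h1
  exact Prod.ext h1 h2

/-- The final first key divides the initial one. [folklore] -/
theorem kiter_fst_dvd {p a F : ℕ} (hp : 0 < p) (hpN : p ≤ N) (hF : 2 * Nat.size N + 1 ≤ F) :
    (kiter F (p, a)).1 ∣ p := by
  rw [kiter_spec hp hpN hF]; exact Nat.gcd_dvd_left p a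

/-- The final first key divides the initial second one. [folklore] -/
theorem kiter_fst_dvd_right {p a F : ℕ} (hp : 0 < p) (hpN : p ≤ N) (hF : 2 * Nat.size N + 1 ≤ F) :
    (kiter F (p, a)).1 ∣ a := by
  rw [kiter_spec hp hpN hF]; exact Nat.gcd_dvd_right p a

/-- If the first key does not divide the second, the final first key is at most half of it.
[folklore] -/
theorem two_mul_kiter_fst_le {p a F : ℕ} (hp : 0 < p) (hpN : p ≤ N) (hF : 2 * Nat.size N + 1 ≤ F)
    (h : ¬ p ∣ a) : 2 * (kiter F (p, a)).1 ≤ p := by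
  rw [kiter_spec hp hpN hF]
  show 2 * Nat.gcd p a ≤ p
  have hd : Nat.gcd p a ∣ p := Nat.gcd_dvd_left p a
  have hne : Nat.gcd p a ≠ p := fun he => h (he ▸ Nat.gcd_dvd_right p a)
  obtain ⟨t, ht⟩ := hd
  have ht2 : 2 ≤ t := by
    by_contra hlt
    have : t = 0 ∨ t = 1 := by omega
    rcases this with rfl | rfl
    · omega
    · rw [mul_one] at ht; exact hne ht.symm
  calc 2 * Nat.gcd p a ≤ t * Nat.gcd p a := Nat.mul_le_mul_right _ ht2
    _ = p := by rw [mul_comm]; exact ht.symm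

/-! ### Euclid on a pair of rows -/

variable (N)

/-- One Euclid step on a pair of rows keyed by their first entries: with `p = u[0]`, `a = v[0]`:
nothing if `a = 0`; otherwise `v' = v - (a / p) • u` (first entry `a mod p`), returning `(u, v')` if
that entry vanished and `(v', u)` otherwise. [folklore] -/
def estep (k : List ℕ × List ℕ) : List ℕ × List ℕ :=
  if k.2.getD 0 0 = 0 then k else
    if (axpy N (k.2.getD 0 0 / k.1.getD 0 0) k.1 k.2).getD 0 0 = 0 then
      (k.1, axpy N (k.2.getD 0 0 / k.1.getD 0 0) k.1 k.2)
    else (axpy N (k.2.getD 0 0 / k.1.getD 0 0) k.1 k.2, k.1)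

/-- `F` Euclid steps on a pair of rows. [folklore] -/
def euclid : ℕ → List ℕ × List ℕ → List ℕ × List ℕ
  | 0, k => k
  | F + 1, k => euclid F (estep N k)

variable {N}

/-- The pair invariant: equal lengths `L` and reduced entries. [folklore] -/
def PairOK (N L : ℕ) (k : List ℕ × List ℕ) : Prop :=
  k.1.length = L ∧ k.2.length = L ∧ (∀ a ∈ k.1, a < N + 1) ∧ ∀ a ∈ k.2, a < N + 1

/-- `estep` preserves the pair invariant. [folklore] -/
theorem pairOK_estep {L : ℕ} {k : List ℕ × List ℕ} (h : PairOK N L k) : PairOK N L (estep N k) := by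
  obtain ⟨h1, h2, h3, h4⟩ := h
  have h12 : k.1.length = k.2.length := h1.trans h2.symm
  have hl : (axpy N (k.2.getD 0 0 / k.1.getD 0 0) k.1 k.2).length = L := by
    rw [length_axpy h12, h2]
  unfold estep
  split_ifs
  · exact ⟨h1, h2, h3, h4⟩
  · exact ⟨h1, hl, h3, axpy_lt h12⟩
  · exact ⟨hl, h1, axpy_lt h12, h3⟩

/-- `euclid` preserves the pair invariant. [folklore] -/
theorem pairOK_euclid {L : ℕ} (F : ℕ) {k : List ℕ × List ℕ} (h : PairOK N L k) :
    PairOK N L (euclid N F k) := by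
  induction F generalizing k with
  | zero => exact h
  | succ F ih => exact ih (pairOK_estep h)

/-- **`estep` preserves the solution set of the pair.** [cite: Schrijver1986, §4.1] -/
theorem sat_estep_iff {c : ℕ} {x : ℕ → ℤ} {k : List ℕ × List ℕ} (h : k.1.length = k.2.length) :
    (Sat N c x (estep N k).1 ∧ Sat N c x (estep N k).2) ↔ (Sat N c x k.1 ∧ Sat N c x k.2) := by
  unfold estep
  split_ifs
  · exact Iff.rfl
  · exact ⟨fun ⟨hu, hv⟩ => ⟨hu, (sat_axpy_iff h hu).1 hv⟩, fun ⟨hu, hv⟩ => ⟨hu, (sat_axpy_iff h hu).2 hv⟩⟩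
  · exact ⟨fun ⟨hv, hu⟩ => ⟨hu, (sat_axpy_iff h hu).1 hv⟩, fun ⟨hu, hv⟩ => ⟨(sat_axpy_iff h hu).2 hv, hu⟩⟩

/-- **`euclid` preserves the solution set of the pair.** [cite: Schrijver1986, §4.1] -/
theorem sat_euclid_iff {c L : ℕ} {x : ℕ → ℤ} (F : ℕ) {k : List ℕ × List ℕ} (h : PairOK N L k) :
    (Sat N c x (euclid N F k).1 ∧ Sat N c x (euclid N F k).2) ↔ (Sat N c x k.1 ∧ Sat N c x k.2) := by
  induction F generalizing k with
  | zero => exact Iff.rfl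
  | succ F ih => rw [euclid, ih (pairOK_estep h), sat_estep_iff (h.1.trans h.2.1.symm)]

/-- The pair of keys of a pair of rows. [folklore] -/
def keys (k : List ℕ × List ℕ) : ℕ × ℕ := (k.1.getD 0 0, k.2.getD 0 0)

/-- The key of the reduced row: `a mod p`. [folklore] -/
theorem getD_axpy_key {L : ℕ} {k : List ℕ × List ℕ} (h : PairOK N L k) (hL : 0 < L) :
    (axpy N (k.2.getD 0 0 / k.1.getD 0 0) k.1 k.2).getD 0 0 = k.2.getD 0 0 % k.1.getD 0 0 := by
  obtain ⟨h1, h2, -, h4⟩ := h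
  have ha : k.2.getD 0 0 < N + 1 := getD_lt_of_reduced h4 0
  rw [getD_axpy (h1.trans h2.symm), if_pos (h2 ▸ hL), msub_eq_sub N (Nat.div_mul_le_self _ _) ha]
  exact Nat.sub_eq_of_eq_add (Nat.mod_add_div' _ _).symm

/-- **The keys of `estep` follow `kstep`** (on reduced rows of equal positive length). [folklore] -/
theorem keys_estep {L : ℕ} {k : List ℕ × List ℕ} (h : PairOK N L k) (hL : 0 < L) :
    keys (estep N k) = kstep (keys k) := by
  have hkey := getD_axpy_key h hL
  by_cases h0 : k.2.getD 0 0 = 0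
  · have e1 : estep N k = k := by unfold estep; rw [if_pos h0]
    have e2 : kstep (keys k) = keys k := kstep_of_snd_eq_zero h0
    rw [e1, e2]
  · by_cases h5 : k.2.getD 0 0 % k.1.getD 0 0 = 0
    · have e1 : estep N k = (k.1, axpy N (k.2.getD 0 0 / k.1.getD 0 0) k.1 k.2) := by
        unfold estep; rw [if_neg h0, if_pos (hkey.trans h5)]
      have e2 : kstep (keys k) = (k.1.getD 0 0, 0) := by
        unfold kstep keys; rw [if_neg h0, if_pos h5]
      rw [e1, e2]; unfold keys; rw [hkey, h5]
    · have e1 : estep N k = (axpy N (k.2.getD 0 0 / k.1.getD 0 0) k.1 k.2, k.1) := by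
        unfold estep; rw [if_neg h0, if_neg (fun h' => h5 (hkey.symm.trans h'))]
      have e2 : kstep (keys k) = (k.2.getD 0 0 % k.1.getD 0 0, k.1.getD 0 0) := by
        unfold kstep keys; rw [if_neg h0, if_neg h5]
      rw [e1, e2]; unfold keys; rw [hkey]

/-- **The keys of `euclid` follow `kiter`.** [folklore] -/
theorem keys_euclid {L : ℕ} (F : ℕ) {k : List ℕ × List ℕ} (h : PairOK N L k) (hL : 0 < L) :
    keys (euclid N F k) = kiter F (keys k) := by
  induction F generalizing k with
  | zero => rfl
  | succ F ih => rw [euclid, kiter, ih (pairOK_estep h), keys_estep h hL]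

/-- A pair whose second key vanishes is fixed by `estep`. [folklore] -/
theorem estep_of_key_eq_zero {k : List ℕ × List ℕ} (h : k.2.getD 0 0 = 0) : estep N k = k := by
  unfold estep; rw [if_pos h]

/-- A pair whose second key vanishes is fixed by `euclid`. [folklore] -/
theorem euclid_of_key_eq_zero (F : ℕ) {k : List ℕ × List ℕ} (h : k.2.getD 0 0 = 0) : euclid N F k = k := by
  induction F with
  | zero => rfl
  | succ F ih =>
    show euclid N F (estep N k) = k
    rw [estep_of_key_eq_zero h]; exact ih

/-- If the first key divides the second, `estep` keeps the first row and kills the second key.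
[folklore] -/
theorem estep_of_dvd {L : ℕ} {k : List ℕ × List ℕ} (h : PairOK N L k) (hL : 0 < L)
    (hd : k.1.getD 0 0 ∣ k.2.getD 0 0) : (estep N k).1 = k.1 ∧ (estep N k).2.getD 0 0 = 0 := by
  have hkey := getD_axpy_key h hL
  by_cases h0 : k.2.getD 0 0 = 0
  · rw [estep_of_key_eq_zero h0]; exact ⟨rfl, h0⟩
  · have h5 : (axpy N (k.2.getD 0 0 / k.1.getD 0 0) k.1 k.2).getD 0 0 = 0 := by
      rw [hkey]; exact Nat.mod_eq_zero_of_dvd hd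
    have e1 : estep N k = (k.1, axpy N (k.2.getD 0 0 / k.1.getD 0 0) k.1 k.2) := by
      unfold estep; rw [if_neg h0, if_pos h5]
    rw [e1]; exact ⟨rfl, h5⟩

/-- **If the first key divides the second, `euclid` does not touch the first row.** [folklore] -/
theorem euclid_fst_eq_of_dvd {L : ℕ} (F : ℕ) {k : List ℕ × List ℕ} (h : PairOK N L k) (hL : 0 < L)
    (hd : k.1.getD 0 0 ∣ k.2.getD 0 0) : (euclid N F k).1 = k.1 := by
  cases F with
  | zero => rfl
  | succ F =>
    show (euclid N F (estep N k)).1 = k.1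
    obtain ⟨h1, h2⟩ := estep_of_dvd h hL hd
    rw [euclid_of_key_eq_zero F h2, h1]

/-! ### Euclid on columns `0` and `j`, keyed by the top row -/

variable (N)

/-- The column transvection `col_j ← col_j - q • col_0` on one row, reduced. [folklore] -/
def colOp (j q : ℕ) (r : List ℕ) : List ℕ := r.set j (msub N (r.getD j 0) (q * r.getD 0 0))

/-- Swapping columns `0` and `j` on one row. [folklore] -/
def swapCols (j : ℕ) (r : List ℕ) : List ℕ := (r.set 0 (r.getD j 0)).set j (r.getD 0 0)

/-- One Euclid step on columns `0` and `j` of a row list, keyed by the top row `t`: with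
`p = t[0]`, `a = t[j]`: nothing if `a = 0`; otherwise `col_j ← col_j - (a / p) • col_0` on every row,
followed by the swap of the two columns unless the new `t[j]` vanished. [folklore] -/
def cstep (j : ℕ) (M : List (List ℕ)) : List (List ℕ) :=
  if (M.headD []).getD j 0 = 0 then M else
    if ((M.map (colOp N j ((M.headD []).getD j 0 / (M.headD []).getD 0 0))).headD []).getD j 0 = 0 then
      M.map (colOp N j ((M.headD []).getD j 0 / (M.headD []).getD 0 0))
    else (M.map (colOp N j ((M.headD []).getD j 0 / (M.headD []).getD 0 0))).map (swapCols j)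

/-- `F` Euclid steps on columns `0` and `j`. [folklore] -/
def ceuclid : ℕ → ℕ → List (List ℕ) → List (List ℕ)
  | 0, _, M => M
  | F + 1, j, M => ceuclid F j (cstep N j M)

variable {N}

/-- Length of `colOp`. [folklore] -/
@[simp] theorem length_colOp (j q : ℕ) (r : List ℕ) : (colOp N j q r).length = r.length := by
  simp [colOp]

/-- Length of `swapCols`. [folklore] -/
@[simp] theorem length_swapCols (j : ℕ) (r : List ℕ) : (swapCols j r).length = r.length := by
  simp [swapCols]

/-- Entries of `colOp`. [folklore] -/
theorem getD_colOp (j q : ℕ) (r : List ℕ) (i : ℕ) :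
    (colOp N j q r).getD i 0 = if i = j ∧ j < r.length then msub N (r.getD j 0) (q * r.getD 0 0) else r.getD i 0 := by
  simp only [colOp, List.getD_eq_getElem?_getD, List.getElem?_set]
  by_cases hij : i = j
  · subst hij
    by_cases hj : i < r.length
    · simp [hj]
    · simp [hj]
  · simp [Ne.symm hij, hij]

/-- Entries of `swapCols` (for `j` inside the row). [folklore] -/
theorem getD_swapCols {j : ℕ} {r : List ℕ} (hj : j < r.length) (i : ℕ) :
    (swapCols j r).getD i 0 = r.getD (Equiv.swap 0 j i) 0 := by
  have h0 : 0 < r.length := lt_of_le_of_lt (Nat.zero_le j) hj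
  simp only [swapCols, List.getD_eq_getElem?_getD, List.getElem?_set, List.length_set]
  rcases eq_or_ne i 0 with rfl | hi0
  · rcases eq_or_ne j 0 with rfl | hj0
    · simp [h0]
    · rw [Equiv.swap_apply_left]; simp [hj0, hj, h0]
  · rcases eq_or_ne i j with rfl | hij
    · rw [Equiv.swap_apply_right]; simp [hj]
    · rw [Equiv.swap_apply_of_ne_of_ne hi0 hij]; simp [Ne.symm hi0, Ne.symm hij]

/-- `colOp` is reduced on reduced rows. [folklore] -/
theorem colOp_lt {j q : ℕ} {r : List ℕ} (h : ∀ a ∈ r, a < N + 1) : ∀ a ∈ colOp N j q r, a < N + 1 := by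
  intro a ha
  rw [colOp] at ha
  rcases List.mem_or_eq_of_mem_set ha with ha | rfl
  · exact h a ha
  · exact msub_lt N _ _

/-- `swapCols` is reduced on reduced rows. [folklore] -/
theorem swapCols_lt {j : ℕ} {r : List ℕ} (h : ∀ a ∈ r, a < N + 1) : ∀ a ∈ swapCols j r, a < N + 1 := by
  intro a ha
  rw [swapCols] at ha
  rcases List.mem_or_eq_of_mem_set ha with ha | rfl
  · rcases List.mem_or_eq_of_mem_set ha with ha | rfl
    · exact h a ha
    · exact getD_lt_of_reduced h j
  · exact getD_lt_of_reduced h 0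

/-- The change of unknowns undoing a column transvection: `x₀ ← x₀ + q x_j`. [folklore] -/
def csubst (j q : ℕ) (x : ℕ → ℤ) : ℕ → ℤ := Function.update x 0 (x 0 + q * x j)

/-- Splitting a sum over `Fin c` at two distinct indices. [folklore] -/
theorem sum_eq_add_add_sum_erase_erase {c : ℕ} (f : Fin c → ℤ) {I J : Fin c} (hIJ : J ≠ I) :
    ∑ i, f i = f I + f J + ∑ i ∈ (univ.erase I).erase J, f i := by
  rw [← Finset.add_sum_erase _ _ (mem_univ I),
    ← Finset.add_sum_erase _ _ (Finset.mem_erase.2 ⟨hIJ, mem_univ J⟩), add_assoc]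

/-- **A column transvection preserves satisfaction up to the change of unknowns** (`1 ≤ j < c`,
row of length `c + 1`). [cite: Schrijver1986, §4.1] -/
theorem sat_colOp_iff {c j q : ℕ} {x : ℕ → ℤ} {r : List ℕ} (hr : r.length = c + 1) (hj1 : 1 ≤ j)
    (hjc : j < c) : Sat N c (csubst j q x) (colOp N j q r) ↔ Sat N c x r := by
  have hjl : j < r.length := by omega
  have hc : 0 < c := by omega
  unfold Sat
  -- right hand sides agree
  have hrhs : ent (colOp N j q r) c = ent r c := by
    unfold ent; rw [getD_colOp, if_neg]; rintro ⟨h, -⟩; omega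
  rw [hrhs]
  -- compare the two sums modulo `N + 1`
  suffices hsum : (∑ i : Fin c, ent (colOp N j q r) i * csubst j q x i) ≡
      ∑ i : Fin c, ent r i * x i [ZMOD ((N : ℤ) + 1)] from
    ⟨fun h => hsum.symm.trans h, fun h => hsum.trans h⟩
  let I : Fin c := ⟨0, hc⟩
  let J : Fin c := ⟨j, hjc⟩
  have hJI : J ≠ I := fun h => by
    have := congrArg Fin.val h
    change j = 0 at this
    omega
  rw [sum_eq_add_add_sum_erase_erase _ hJI, sum_eq_add_add_sum_erase_erase _ hJI]
  have hrest : ∑ i ∈ (univ.erase I).erase J, ent (colOp N j q r) i * csubst j q x i =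
      ∑ i ∈ (univ.erase I).erase J, ent r i * x i := by
    refine Finset.sum_congr rfl fun i hi => ?_
    simp only [mem_erase, ne_eq, mem_univ, and_true] at hi
    have hi0 : (i : ℕ) ≠ 0 := fun h => hi.2 (Fin.ext h)
    have hij : (i : ℕ) ≠ j := fun h => hi.1 (Fin.ext h)
    unfold ent csubst
    rw [getD_colOp, if_neg (fun h => hij h.1), Function.update_of_ne hi0]
  rw [hrest]
  refine Int.ModEq.add_right _ ?_
  have eI : ent (colOp N j q r) (I : ℕ) = ent r 0 := by
    unfold ent; rw [getD_colOp, if_neg]; rintro ⟨h, -⟩; change 0 = j at h; omega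
  have eJ : ent (colOp N j q r) (J : ℕ) ≡ ent r j - q * ent r 0 [ZMOD ((N : ℤ) + 1)] := by
    unfold ent; rw [getD_colOp, if_pos ⟨rfl, hjl⟩]
    simpa using msub_modEq N (r.getD j 0) (q * r.getD 0 0)
  have xI : csubst j q x (I : ℕ) = x 0 + q * x j := by
    change Function.update x 0 (x 0 + q * x j) 0 = _; rw [Function.update_self]
  have xJ : csubst j q x (J : ℕ) = x j := by
    change Function.update x 0 (x 0 + q * x j) j = _; rw [Function.update_of_ne]; omega
  have rI : ent r (I : ℕ) = ent r 0 := rfl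
  have rJ : ent r (J : ℕ) = ent r j := rfl
  rw [eI, xI, xJ, rI, rJ]
  have h1 := (eJ.mul_right (x j)).add_left (ent r 0 * (x 0 + q * x j))
  refine h1.trans ?_
  have e : ent r 0 * (x 0 + ↑q * x j) + (ent r j - ↑q * ent r 0) * x j = ent r 0 * x 0 + ent r j * x j := by ring
  rw [e]

/-- `csubst` is a bijection of the unknowns (explicit inverse). [folklore] -/
theorem csubst_surjective (j q : ℕ) (hj : 1 ≤ j) : Function.Surjective (csubst j q) := by
  intro y
  refine ⟨Function.update y 0 (y 0 - q * y j), ?_⟩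
  funext i
  unfold csubst
  rcases eq_or_ne i 0 with rfl | hi
  · rw [Function.update_self, Function.update_self, Function.update_of_ne (show j ≠ 0 by omega)]; ring
  · rw [Function.update_of_ne hi, Function.update_of_ne hi]

/-- **A column swap preserves satisfaction up to permuting the unknowns** (`j < c`, row of length
`c + 1`). [cite: Schrijver1986, §4.1] -/
theorem sat_swapCols_iff {c j : ℕ} {x : ℕ → ℤ} {r : List ℕ} (hr : r.length = c + 1) (hjc : j < c) :
    Sat N c (x ∘ Equiv.swap 0 j) (swapCols j r) ↔ Sat N c x r := by
  have hjl : j < r.length := by omega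
  unfold Sat
  have hrhs : ent (swapCols j r) c = ent r c := by
    unfold ent; rw [getD_swapCols hjl, Equiv.swap_apply_of_ne_of_ne (by omega) (by omega)]
  rw [hrhs]
  have hc : 0 < c := by omega
  let σ : Equiv.Perm (Fin c) := Equiv.swap ⟨0, hc⟩ ⟨j, hjc⟩
  have hσ : ∀ i : Fin c, ((σ i : Fin c) : ℕ) = Equiv.swap 0 j (i : ℕ) := by
    intro i
    by_cases h0 : i = ⟨0, hc⟩
    · subst h0; change ((Equiv.swap _ _ _ : Fin c) : ℕ) = _; rw [Equiv.swap_apply_left]; simp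
    · by_cases h1 : i = ⟨j, hjc⟩
      · subst h1; change ((Equiv.swap _ _ _ : Fin c) : ℕ) = _; rw [Equiv.swap_apply_right]; simp
      · change ((Equiv.swap _ _ _ : Fin c) : ℕ) = _
        rw [Equiv.swap_apply_of_ne_of_ne h0 h1, Equiv.swap_apply_of_ne_of_ne]
        · exact fun h => h0 (Fin.ext h)
        · exact fun h => h1 (Fin.ext h)
  have hsum : (∑ i : Fin c, ent (swapCols j r) i * (x ∘ Equiv.swap 0 j) i) = ∑ i : Fin c, ent r i * x i := by
    have : ∀ i : Fin c, ent (swapCols j r) i * (x ∘ Equiv.swap 0 j) i = (fun k : Fin c => ent r k * x k) (σ i) := by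
      intro i
      simp only [Function.comp_apply]
      unfold ent
      rw [getD_swapCols hjl, ← hσ]
    simp_rw [this]
    exact Equiv.sum_comp σ (fun k : Fin c => ent r k * x k)
  rw [hsum]

/-- `cstep` on a nonempty row list, unfolded. [folklore] -/
theorem cstep_cons (j : ℕ) (t : List ℕ) (M : List (List ℕ)) :
    cstep N j (t :: M) =
      if t.getD j 0 = 0 then t :: M else
        if (colOp N j (t.getD j 0 / t.getD 0 0) t).getD j 0 = 0 then
          (t :: M).map (colOp N j (t.getD j 0 / t.getD 0 0))
        else ((t :: M).map (colOp N j (t.getD j 0 / t.getD 0 0))).map (swapCols j) := rfl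

/-- Every row of `cstep N j M` is the image of the corresponding row of `M` under one of: the
identity, `colOp`, or `swapCols ∘ colOp` — recorded as the three-way shape of `cstep`. [folklore] -/
theorem cstep_cases (j : ℕ) (M : List (List ℕ)) :
    cstep N j M = M ∨ (∃ q, cstep N j M = M.map (colOp N j q)) ∨
      ∃ q, cstep N j M = (M.map (colOp N j q)).map (swapCols j) := by
  unfold cstep
  split_ifs
  · exact Or.inl rfl
  · exact Or.inr (Or.inl ⟨_, rfl⟩)
  · exact Or.inr (Or.inr ⟨_, rfl⟩)

/-- `cstep` preserves well-formedness. [folklore] -/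
theorem wf_cstep {c j : ℕ} {M : List (List ℕ)} (h : WF c M) : WF c (cstep N j M) := by
  rcases cstep_cases (N := N) j M with e | ⟨q, e⟩ | ⟨q, e⟩ <;> rw [e]
  · exact h
  · intro r hr; obtain ⟨r', hr', rfl⟩ := List.mem_map.1 hr; simpa using h r' hr'
  · intro r hr
    obtain ⟨r'', hr'', rfl⟩ := List.mem_map.1 hr
    obtain ⟨r', hr', rfl⟩ := List.mem_map.1 hr''
    simpa using h r' hr'

/-- `cstep` preserves reducedness. [folklore] -/
theorem reduced_cstep {j : ℕ} {M : List (List ℕ)} (h : Reduced N M) : Reduced N (cstep N j M) := by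
  rcases cstep_cases (N := N) j M with e | ⟨q, e⟩ | ⟨q, e⟩ <;> rw [e]
  · exact h
  · intro r hr; obtain ⟨r', hr', rfl⟩ := List.mem_map.1 hr; exact colOp_lt (h r' hr')
  · intro r hr
    obtain ⟨r'', hr'', rfl⟩ := List.mem_map.1 hr
    obtain ⟨r', hr', rfl⟩ := List.mem_map.1 hr''
    exact swapCols_lt (colOp_lt (h r' hr'))

/-- `cstep` preserves the number of rows. [folklore] -/
@[simp] theorem length_cstep (j : ℕ) (M : List (List ℕ)) : (cstep N j M).length = M.length := by
  rcases cstep_cases (N := N) j M with e | ⟨q, e⟩ | ⟨q, e⟩ <;> rw [e] <;> simp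

/-- Solvability is invariant under a column transvection of all rows. [cite: Schrijver1986, §4.1] -/
theorem solvable_map_colOp_iff {c j : ℕ} (q : ℕ) {M : List (List ℕ)} (hM : WF c M) (hj1 : 1 ≤ j)
    (hjc : j < c) : Solvable N c (M.map (colOp N j q)) ↔ Solvable N c M := by
  constructor
  · rintro ⟨y, hy⟩
    obtain ⟨x, rfl⟩ := csubst_surjective j q hj1 y
    exact ⟨x, fun r hr => (sat_colOp_iff (hM r hr) hj1 hjc).1 (hy _ (List.mem_map_of_mem hr))⟩
  · rintro ⟨x, hx⟩
    refine ⟨csubst j q x, fun r hr => ?_⟩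
    obtain ⟨r', hr', rfl⟩ := List.mem_map.1 hr
    exact (sat_colOp_iff (hM r' hr') hj1 hjc).2 (hx r' hr')

/-- Solvability is invariant under a column swap of all rows. [cite: Schrijver1986, §4.1] -/
theorem solvable_map_swapCols_iff {c j : ℕ} {M : List (List ℕ)} (hM : WF c M) (hjc : j < c) :
    Solvable N c (M.map (swapCols j)) ↔ Solvable N c M := by
  constructor
  · rintro ⟨y, hy⟩
    refine ⟨y ∘ Equiv.swap 0 j, fun r hr => ?_⟩
    have h1 := hy _ (List.mem_map_of_mem hr)
    have e : (y ∘ Equiv.swap 0 j) ∘ Equiv.swap 0 j = y := by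
      funext i; simp [Equiv.swap_apply_self]
    rw [← e] at h1
    exact (sat_swapCols_iff (hM r hr) hjc).1 h1
  · rintro ⟨x, hx⟩
    refine ⟨x ∘ Equiv.swap 0 j, fun r hr => ?_⟩
    obtain ⟨r', hr', rfl⟩ := List.mem_map.1 hr
    exact (sat_swapCols_iff (hM r' hr') hjc).2 (hx r' hr')

/-- **`cstep` preserves solvability** (`1 ≤ j < c`). [cite: Schrijver1986, §4.1] -/
theorem solvable_cstep_iff {c j : ℕ} {M : List (List ℕ)} (h : WF c M) (hj1 : 1 ≤ j) (hjc : j < c) :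
    Solvable N c (cstep N j M) ↔ Solvable N c M := by
  rcases cstep_cases (N := N) j M with e | ⟨q, e⟩ | ⟨q, e⟩ <;> rw [e]
  · exact solvable_map_colOp_iff q h hj1 hjc
  · have h' : WF c (M.map (colOp N j q)) := by
      intro r hr; obtain ⟨r', hr', rfl⟩ := List.mem_map.1 hr; simpa using h r' hr'
    rw [solvable_map_swapCols_iff h' hjc]
    exact solvable_map_colOp_iff q h hj1 hjc

/-- `ceuclid` preserves well-formedness, reducedness, length and solvability. [cite: Schrijver1986, §4.1] -/
theorem ceuclid_invariants {c j : ℕ} (F : ℕ) {M : List (List ℕ)} (h : WF c M) (hr : Reduced N M)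
    (hj1 : 1 ≤ j) (hjc : j < c) :
    WF c (ceuclid N F j M) ∧ Reduced N (ceuclid N F j M) ∧ (ceuclid N F j M).length = M.length ∧
      (Solvable N c (ceuclid N F j M) ↔ Solvable N c M) := by
  induction F generalizing M with
  | zero => exact ⟨h, hr, rfl, Iff.rfl⟩
  | succ F ih =>
    obtain ⟨h1, h2, h3, h4⟩ := ih (wf_cstep h) (reduced_cstep hr)
    exact ⟨h1, h2, h3.trans (length_cstep j M), h4.trans (solvable_cstep_iff h hj1 hjc)⟩

/-- The pair of keys of the column engine: entries `0` and `j` of the top row. [folklore] -/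
def ckeys (j : ℕ) (M : List (List ℕ)) : ℕ × ℕ := ((M.headD []).getD 0 0, (M.headD []).getD j 0)

/-- The new key `t[j]` after the column transvection is `t[j] mod t[0]`. [folklore] -/
theorem getD_colOp_key {j : ℕ} {t : List ℕ} (ht : ∀ a ∈ t, a < N + 1) (hjl : j < t.length) :
    (colOp N j (t.getD j 0 / t.getD 0 0) t).getD j 0 = t.getD j 0 % t.getD 0 0 := by
  rw [getD_colOp, if_pos ⟨rfl, hjl⟩, msub_eq_sub N (Nat.div_mul_le_self _ _) (getD_lt_of_reduced ht j)]
  exact Nat.sub_eq_of_eq_add (Nat.mod_add_div' _ _).symm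

/-- Column `0` is untouched by the column transvection (`j ≠ 0`). [folklore] -/
theorem getD_colOp_zero {j q : ℕ} (t : List ℕ) (hj : j ≠ 0) : (colOp N j q t).getD 0 0 = t.getD 0 0 := by
  rw [getD_colOp, if_neg (fun h => hj h.1.symm)]

/-- **The keys of `cstep` follow `kstep`** (top row reduced, `1 ≤ j < |top|`). [folklore] -/
theorem ckeys_cstep {j : ℕ} {t : List ℕ} {M : List (List ℕ)} (ht : ∀ a ∈ t, a < N + 1) (hj1 : 1 ≤ j)
    (hjl : j < t.length) : ckeys j (cstep N j (t :: M)) = kstep (ckeys j (t :: M)) := by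
  have hj0 : j ≠ 0 := by omega
  have hkeyj := getD_colOp_key (N := N) ht hjl
  have hkey0 := getD_colOp_zero (N := N) (q := t.getD j 0 / t.getD 0 0) t hj0
  have hjl' : j < (colOp N j (t.getD j 0 / t.getD 0 0) t).length := by simpa using hjl
  have ek : ckeys j (t :: M) = (t.getD 0 0, t.getD j 0) := rfl
  rw [ek, cstep_cons]
  by_cases h0 : t.getD j 0 = 0
  · rw [if_pos h0, kstep_of_snd_eq_zero h0]; exact ek.trans (by rw [h0])
  · rw [if_neg h0, hkeyj]
    unfold kstep
    rw [if_neg h0]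
    by_cases h5 : t.getD j 0 % t.getD 0 0 = 0
    · rw [if_pos h5, if_pos h5]
      show ((colOp N j _ t).getD 0 0, (colOp N j _ t).getD j 0) = _
      rw [hkey0, hkeyj, h5]
    · rw [if_neg h5, if_neg h5]
      show ((swapCols j (colOp N j _ t)).getD 0 0, (swapCols j (colOp N j _ t)).getD j 0) = _
      rw [getD_swapCols hjl', getD_swapCols hjl', Equiv.swap_apply_left, Equiv.swap_apply_right, hkeyj, hkey0]

/-- `cstep` of a nonempty row list is nonempty. [folklore] -/
theorem cstep_cons_eq (j : ℕ) (t : List ℕ) (M : List (List ℕ)) :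
    ∃ t' M', cstep N j (t :: M) = t' :: M' := by
  rcases cstep_cases (N := N) j (t :: M) with e | ⟨q, e⟩ | ⟨q, e⟩ <;> rw [e]
  · exact ⟨t, M, rfl⟩
  · exact ⟨_, _, rfl⟩
  · exact ⟨_, _, rfl⟩

/-- **The keys of `ceuclid` follow `kiter`.** [folklore] -/
theorem ckeys_ceuclid {j L : ℕ} (F : ℕ) {t : List ℕ} {M : List (List ℕ)} (hred : Reduced N (t :: M))
    (hwf : ∀ r ∈ t :: M, r.length = L) (hj1 : 1 ≤ j) (hjl : j < L) :
    ckeys j (ceuclid N F j (t :: M)) = kiter F (ckeys j (t :: M)) := by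
  induction F generalizing t M with
  | zero => rfl
  | succ F ih =>
    have htl : t.length = L := hwf t List.mem_cons_self
    rw [ceuclid, kiter, ← ckeys_cstep (hred t List.mem_cons_self) hj1 (htl ▸ hjl)]
    obtain ⟨t', M', he⟩ := cstep_cons_eq (N := N) j t M
    have hred' : Reduced N (cstep N j (t :: M)) := reduced_cstep hred
    obtain ⟨L', rfl⟩ : ∃ L', L = L' + 1 := ⟨L - 1, by omega⟩
    have hwf' : WF L' (cstep N j (t :: M)) := wf_cstep hwf
    rw [he] at hred' hwf' ⊢
    exact ih hred' hwf'

/-- A row list whose key `t[j]` vanishes is fixed by `cstep`. [folklore] -/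
theorem cstep_of_key_eq_zero {j : ℕ} {M : List (List ℕ)} (h : (M.headD []).getD j 0 = 0) : cstep N j M = M := by
  unfold cstep; rw [if_pos h]

/-- A row list whose key `t[j]` vanishes is fixed by `ceuclid`. [folklore] -/
theorem ceuclid_of_key_eq_zero (F : ℕ) {j : ℕ} {M : List (List ℕ)} (h : (M.headD []).getD j 0 = 0) :
    ceuclid N F j M = M := by
  induction F with
  | zero => rfl
  | succ F ih => show ceuclid N F j (cstep N j M) = M; rw [cstep_of_key_eq_zero h]; exact ih

/-- **If the pivot divides the key, `cstep` is a single column transvection** (or nothing).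
[folklore] -/
theorem cstep_of_dvd {j : ℕ} {t : List ℕ} {M : List (List ℕ)} (ht : ∀ a ∈ t, a < N + 1)
    (hjl : j < t.length) (hd : t.getD 0 0 ∣ t.getD j 0) :
    cstep N j (t :: M) = (t :: M).map (colOp N j (t.getD j 0 / t.getD 0 0)) ∨ cstep N j (t :: M) = t :: M := by
  by_cases h0 : t.getD j 0 = 0
  · right; rw [cstep_cons, if_pos h0]
  · left
    rw [cstep_cons, if_neg h0, if_pos]
    rw [getD_colOp_key ht hjl]
    exact Nat.mod_eq_zero_of_dvd hd

/-- After a dividing step the key vanishes, so `ceuclid` is that single step. [folklore] -/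
theorem ceuclid_of_dvd {j : ℕ} (F : ℕ) {t : List ℕ} {M : List (List ℕ)} (ht : ∀ a ∈ t, a < N + 1)
    (hj1 : 1 ≤ j) (hjl : j < t.length) (hd : t.getD 0 0 ∣ t.getD j 0) (hF : 1 ≤ F) :
    ceuclid N F j (t :: M) = (t :: M).map (colOp N j (t.getD j 0 / t.getD 0 0)) ∨
      ceuclid N F j (t :: M) = t :: M := by
  obtain ⟨F, rfl⟩ := Nat.exists_eq_add_of_le' hF
  rw [ceuclid]
  rcases cstep_of_dvd (N := N) (M := M) ht hjl hd with e | e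
  · left
    rw [e]
    apply ceuclid_of_key_eq_zero
    show ((colOp N j (t.getD j 0 / t.getD 0 0) t :: M.map _).headD []).getD j 0 = 0
    rw [List.headD_cons, getD_colOp_key ht hjl]
    exact Nat.mod_eq_zero_of_dvd hd
  · right
    rw [e]
    have h0 : t.getD j 0 = 0 := by
      by_contra h0
      rw [cstep_cons, if_neg h0] at e
      split_ifs at e with h5
      · have := congrArg (fun l => (l.headD []).getD j 0) e
        simp only [List.map_cons, List.headD_cons] at this
        rw [this] at h5; exact h0 h5
      · have := congrArg (fun l => (l.headD []).getD j 0) e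
        simp only [List.map_cons, List.headD_cons] at this
        have hjl' : j < (colOp N j (t.getD j 0 / t.getD 0 0) t).length := by simpa using hjl
        have hj0 : j ≠ 0 := Nat.one_le_iff_ne_zero.1 hj1
        rw [getD_swapCols hjl', Equiv.swap_apply_right, getD_colOp_zero t hj0] at this
        -- `t[0] = t[j]`, so `t[j] mod t[0] = 0`, contradicting `h5`
        apply h5
        rw [getD_colOp_key ht hjl]
        exact Nat.mod_eq_zero_of_dvd hd
    exact ceuclid_of_key_eq_zero F (by simpa using h0)

end ModDiag

end Literature.LinearAlgebra.Matrix
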